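import Summits.AnomalousDissipation.AnomalousDissipation.Theorems.SteadyWeakLimitWeakLimitSubsolution
import Summits.AnomalousDissipation.AnomalousDissipation.Theorems.SteadyWeakLimitInjectionWeaklyContinuous
import Literature.Analysis.FluidPDE.ReynoldsDefectMeasureExistence

/-!
# Route SteadyWeakLimit — the support `WeakLimitSubsolution`, unconditional form

Item stmt-AnomalousDissipation-1340 (`WeakLimitSubsolution`; informal-only in the route file, no
Lean signature filed yet). With the DiPerna–Majda existence of Reynolds defect measures now
discharged in the tree (`Literature.Analysis.FluidPDE.Torus.exists_isReynoldsDefectOf_subseq_holds`,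
`ReynoldsDefectMeasureExistence.lean`), the conditional structure theorem
`steadyWeakLimit_weakLimitSubsolution` (`SteadyWeakLimitWeakLimitSubsolution.lean`) becomes
unconditional, and the dissipation clause `ν j ‖∇u j‖² → ∫ ⟪f, v⟫` of the informal text is the
landed support `injectionWeaklyContinuous_proof` with constant forces `fs j = f`.

`steadyWeakLimit_weakLimitSubsolution_holds` is stated in the exact `∀`-form proposed as the
item's signature: along any `L²`-bounded family of steady classical Navier–Stokes states `u j` on
`T³` (fixed force `f`, viscosities `ν j → 0`) converging weakly in `L²` to `v ∈ L²`,
(i) `ν j ‖∇u j‖₂² → ∫ ⟪f, v⟫`, and (ii) a subsequence `u ∘ φ` has a Reynolds defect measure `R`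
(`u (φ n) ⊗ u (φ n) dx ⇀* v ⊗ v dx + R`, `R ⪰ 0` finite symmetric matrix-valued Borel), `(v, R)`
is a stationary Euler–Reynolds subsolution with source `f`
(`∫ (⟪v, (v·∇)w⟫ + ⟪f, w⟫) + ∫ ∇w : dR = 0` for smooth divergence-free `w`), and
`∫ |u (φ n)|² → ∫ |v|² + tr R (T³)` (energy defect = trace mass).
-/

namespace Summit.AnomalousDissipation.AnomalousDissipation.Theorems

-- the mandated namespace `Summit.<Summit>.<Problem>.Theorems` repeats `AnomalousDissipation` (single-problem summit)
set_option linter.dupNamespace false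

open MeasureTheory Filter Topology
open scoped InnerProductSpace
open Literature.Analysis.FunctionSpaces Literature.Analysis.FunctionSpaces.Torus
open Literature.Analysis.FluidPDE Literature.Analysis.FluidPDE.Torus
open Summit.AnomalousDissipation.AnomalousDissipation.Theses.SteadyWeakLimit

/-- **Steady dissipation converges to the injection at fixed force**: along steady classical
states `(u j, p j)` of `NS_{ν j}(f)` on `T³` with `∫ ‖u j‖² ≤ E` and `u j ⇀ v` weakly in `L²`,
`ν j ‖∇u j‖₂² → ∫ ⟪f, v⟫` (the landed support `injectionWeaklyContinuous_proof` with `fs j = f`;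
the force of a steady classical state is automatically smooth). [folklore] -/
theorem steadyWeakLimit_tendsto_dissipation
    {f : UnitAddTorus (Fin 3) → EuclideanSpace ℝ (Fin 3)} {ν : ℕ → ℝ}
    {u : ℕ → UnitAddTorus (Fin 3) → EuclideanSpace ℝ (Fin 3)} {p : ℕ → UnitAddTorus (Fin 3) → ℝ}
    {v : UnitAddTorus (Fin 3) → EuclideanSpace ℝ (Fin 3)} {E : ℝ}
    (hNS : ∀ j, IsClassicalNSSolutionOn Set.univ (ν j) (fun _ => f) (fun _ => u j) (fun _ => p j))
    (hE : ∀ j, ∫ x, ‖u j x‖ ^ 2 ≤ E)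
    (hweak : ∀ w : UnitAddTorus (Fin 3) → EuclideanSpace ℝ (Fin 3), IsSmooth w →
      Tendsto (fun j => ∫ x, ⟪w x, u j x⟫_ℝ) atTop (𝓝 (∫ x, ⟪w x, v x⟫_ℝ))) :
    Tendsto (fun j => ν j * gradNormSq (u j)) atTop (𝓝 (∫ x, ⟪f x, v x⟫_ℝ)) := by
  have hf : IsSmooth f := steadyWeakLimit_isSmooth_force (hNS 0)
  have h0 : Tendsto (fun j : ℕ => eLpNorm ((fun _ : ℕ => f) j - f) 2 volume) atTop (𝓝 0) := by
    simp only [sub_self, eLpNorm_zero]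
    exact tendsto_const_nhds
  exact injectionWeaklyContinuous_proof f v ν (fun _ => f) u p E hf (fun _ => hf) h0 hNS hE hweak

/-- **`WeakLimitSubsolution` (item stmt-AnomalousDissipation-1340), unconditional, in the `∀`-form
proposed as the item's signature.** On `T³`: for steady classical Navier–Stokes states `(u j, p j)`
of `NS_{ν j}(f)` with `ν j → 0`, `∫ ‖u j‖² ≤ E`, converging weakly in `L²` (pairings with smooth
fields) to `v ∈ L²`:
(i) `ν j ‖∇u j‖₂² → ∫ ⟪f, v⟫` (`InjectionWeaklyContinuous`), and
(ii) there are a subsequence `φ` and a positive semidefinite matrix-valued finite Borel measure `R`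
(DiPerna–Majda) with `u (φ n) ⊗ u (φ n) dx ⇀* v ⊗ v dx + R` (`Torus.IsReynoldsDefectOf`), `(v, R)`
a stationary Euler–Reynolds subsolution with source `f` (`Torus.IsSteadyEulerReynoldsSubsolution`:
`v` weakly divergence free, `R ⪰ 0`, `∫ (⟪v, (v·∇)w⟫ + ⟪f, w⟫) + ∫ ∇w : dR = 0` for smooth
divergence-free `w`), and `∫ ‖u (φ n)‖² → ∫ ‖v‖² + tr R (T³)`.
Sources: DiPerna–Majda 1987, §1; De Lellis–Székelyhidi 2012, §2.2; Majda–Bertozzi 2002, §11.1. -/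
theorem steadyWeakLimit_weakLimitSubsolution_holds :
    ∀ (f : UnitAddTorus (Fin 3) → EuclideanSpace ℝ (Fin 3)) (ν : ℕ → ℝ)
      (u : ℕ → UnitAddTorus (Fin 3) → EuclideanSpace ℝ (Fin 3)) (p : ℕ → UnitAddTorus (Fin 3) → ℝ)
      (v : UnitAddTorus (Fin 3) → EuclideanSpace ℝ (Fin 3)),
      Filter.Tendsto ν Filter.atTop (nhds 0) →
      (∀ j, Literature.Analysis.FunctionSpaces.Torus.IsClassicalNSSolutionOn Set.univ (ν j)
        (fun _ => f) (fun _ => u j) (fun _ => p j)) →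
      (∃ E : ℝ, ∀ j, MeasureTheory.integral MeasureTheory.volume (fun x => ‖u j x‖ ^ 2) ≤ E) →
      MeasureTheory.MemLp v 2 MeasureTheory.volume →
      (∀ w : UnitAddTorus (Fin 3) → EuclideanSpace ℝ (Fin 3),
        Literature.Analysis.FunctionSpaces.Torus.IsSmooth w →
          Filter.Tendsto (fun j => MeasureTheory.integral MeasureTheory.volume
            (fun x => inner ℝ (w x) (u j x))) Filter.atTop
            (nhds (MeasureTheory.integral MeasureTheory.volume (fun x => inner ℝ (w x) (v x))))) →
      Filter.Tendsto (fun j => ν j * Literature.Analysis.FunctionSpaces.Torus.gradNormSq (u j))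
          Filter.atTop
          (nhds (MeasureTheory.integral MeasureTheory.volume (fun x => inner ℝ (f x) (v x)))) ∧
        ∃ φ : ℕ → ℕ, StrictMono φ ∧
          ∃ R : Literature.Analysis.FluidPDE.MatrixMeasure (Fin 3) (UnitAddTorus (Fin 3)),
            Literature.Analysis.FluidPDE.Torus.IsReynoldsDefectOf (u ∘ φ) v R ∧
              Literature.Analysis.FluidPDE.Torus.IsSteadyEulerReynoldsSubsolution f v R ∧
                Filter.Tendsto (fun n => MeasureTheory.integral MeasureTheory.volume
                  (fun x => ‖u (φ n) x‖ ^ 2)) Filter.atTop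
                  (nhds (MeasureTheory.integral MeasureTheory.volume (fun x => ‖v x‖ ^ 2) +
                    R.traceMass)) := by
  intro f ν u p v hν hNS hE hv hweak
  obtain ⟨E, hE'⟩ := hE
  exact ⟨steadyWeakLimit_tendsto_dissipation hNS hE' hweak,
    steadyWeakLimit_weakLimitSubsolution (exists_isReynoldsDefectOf_subseq_holds (Fin 3))
      f ν u p v hν hNS ⟨E, hE'⟩ hv hweak⟩

end Summit.AnomalousDissipation.AnomalousDissipation.Theorems
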